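import Summits.BirchSwinnertonDyer.BirchSwinnertonDyer.Theorems.ResidualThetaTransportAtTwoRlfLayerWitnessDict
import Summits.BirchSwinnertonDyer.BirchSwinnertonDyer.Theorems.ResidualThetaTransportAtTwoRlfLayerWitnessClassAt
import Summits.BirchSwinnertonDyer.BirchSwinnertonDyer.Theorems.ResidualThetaTransportAtTwoRlfLayerClassPairingCompat
import HarnessLib

/-!
# Route `ResidualThetaTransportAtTwo` (RTT P6, item stmt-BirchSwinnertonDyer-23110, road T), ISO θ-plan, LAYER DICTIONARY — the NORM step
# across consecutive layers at the level of witness points, and the two cosets of `U_{n+1}` in `U_n`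

Lead seat `bsd-wall-tp2-p2x` g13 (cell `bsd-wall`), line `hplusdual` on 23110 (stub `stub_iso` ⟸ LAYER-ISO ⟸ θ-plan). THEOREMS ONLY (no
definition, no named fact, no instance, no `sorry`); closes nothing; 23110 is NOT proved; BSD is NOT proved by any of this.

Setting as in `…RlfLayerWitnessDict`: `W/ℚ` globally minimal, `GoodSS W 2`, `κ` a `ℤ₂`-extension, `v ∋ 2`, `N = Gal(ℚ̄_v/ℚ_{v,∞})`,
`U_n = LayerPairing.layerGroup κ v n`, `g ∈ Γ_v` a local lift of the topological generator, `A = ⋃ₙ E⁺(ℚ_{v,n})`; a WITNESS of a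
continuous `U_n`-cocycle `f` of `E[2^J]|` is a point `Q` with `f(τ) = τQ − Q` on points for `τ ∈ N` (and `2^k Q ∈ A`).

* §1 `exists_smul_sub_eq_of_layerWitness` — **every `σ ∈ U_n` moves the witness point `a = 2^J Q` inside its class: `σ a − a ∈ 2^J A`**
  (the cocycle identity at `(σ, τ)`; `…LayerWitnessDict.exists_layerEigen_of_layerWitness` is `σ = g^{2^n}`).
* §2 `mem_layerGroup_succ_or`, `pow_not_mem_layerGroup_succ`, `quotient_layerGroup_eq_or`, `sum_quotient_layerGroup_eq` —
  `U_n = U_{n+1} ⊔ g^{2^n} U_{n+1}`: the quotient `U_n ⧸ U_{n+1}` has exactly the two classes of `1` and `g^{2^n}`, so a sum over it is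
  the sum of the two values (`κ(U_n) = 2^n ℤ₂`, `ℤ₂/2ℤ₂ = {0, 1}` by `PadicInt.zmodRepr`).
* §3 **`exists_coresLe_witness_norm`** — the NORM STEP on witness points: for a `U_{n+1}`-cocycle `f` with witness `Q`, `2^J Q ∈ A`, a
  representative `F` of `cor_{U_{n+1}→U_n}[f]` has a witness `Q'` with `2^J Q' ≡ a + g^{2^n} a (mod 2^J A)`, `a = 2^J Q` — i.e. on the
  realization `S` of `A ⊗ ℚ₂/ℤ₂` the class of `cor f` sits at `N_{n+1/n} s = s + φ^{2^n} s` (B. D. Kim: «`Cor^m_n(H_m[p^j]) = H_n[p^j]`» on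
  points; input (P1′) of the θ-extraction). Uses `LayerClassPairing.exists_coresLe_cocycle_of_layerWitness` (D5).

References: B. D. Kim, Compositio Math. 143 (2007), Prop. 3.15 (proof, pp. 56–57) [BDKim2007]; J. Neukirch, A. Schmidt, K. Wingberg,
*Cohomology of Number Fields* (2008), I §5 (1.5.6)–(1.5.7) [NeukirchSchmidtWingberg2008]; L. Washington, *Cyclotomic Fields* §13.1
[Washington1997]; S. Kobayashi, Invent. math. 152 (2003), Def. 1.1 [Kobayashi2003].
-/

-- the Theorems namespace of this sub repeats the summit name by design (D-0017 nested layout)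
set_option linter.dupNamespace false

noncomputable section

open scoped Classical NumberField
open CategoryTheory Function Field NumberField IsDedekindDomain

namespace Summit.BirchSwinnertonDyer.BirchSwinnertonDyer.Theorems.SignedEC.LayerIsoAssembly

open Literature.NumberTheory.EllipticCurves Literature.NumberTheory.GaloisRepresentations WeierstrassCurve ZpExtension
  Literature.NumberTheory.EllipticCurves.Kobayashi2003 Literature.NumberTheory.EllipticCurves.Sprung2012 SignedKatoOffTwo
  TwistedLocalKummer LayerWitnessDict
open scoped ContRepresentation

universe u

variable (W : WeierstrassCurve ℚ) [W.IsElliptic] [W.IsGloballyMinimal]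

/-! ## §1 Every `σ ∈ U_n` moves a witness point inside its class -/

/-- **`σ • (2^J Q) − 2^J Q ∈ 2^J A` for every `σ ∈ U_n`** and every witness `(f, Q, k)` of a `U_n`-class: the cocycle identity at
`(σ, τ)` and `(σ⁻¹ τ σ, σ)` shows that `σQ − Q − ι f(σ)` is fixed by `N`; multiply by `2^J` (killing `ι f(σ) ∈ E[2^J]`) and saturate.
[cite: BDKim2007, Prop. 3.15 (proof)] [cite: GreenbergLNM1716, §4 p. 124] -/
theorem exists_smul_sub_eq_of_layerWitness (hss : Rank1Residual.GoodSS W 2) (κ : ZpExtension ℚ 2) (J n : ℕ)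
    (v : HeightOneSpectrum (𝓞 ℚ)) (hv : (2 : 𝓞 ℚ) ∈ v.asIdeal)
    (f : contOneCocycles (subgroupRep (LayerPairing.torsionLocalRep W (2 ^ J) v) (LayerPairing.layerGroup κ v n)))
    (Q : localPoints W (v.adicCompletion ℚ)) {k : ℕ}
    (hkQ : 2 ^ k • Q ∈ (⨆ i, signedLocalPoints κ (v.adicCompletion ℚ) W 1 i))
    (hf : ∀ (τ : absoluteGaloisGroup (v.adicCompletion ℚ)) (hτ : τ ∈ localSubgroup κ.kerSubgroup (v.adicCompletion ℚ)),
      pointsMap W (v.adicCompletion ℚ) ((f.1 ⟨τ, TwistLayer.localSubgroup_le_layerGroup κ v n hτ⟩ : W.geomTorsion ((2 ^ J : ℕ) : ℤ)) :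
        W.geomPoints) = τ • Q - Q)
    (σ : absoluteGaloisGroup (v.adicCompletion ℚ)) (hσ : σ ∈ LayerPairing.layerGroup κ v n) :
    ∃ w ∈ (⨆ i, signedLocalPoints κ (v.adicCompletion ℚ) W 1 i), σ • (2 ^ J • Q) - 2 ^ J • Q = 2 ^ J • w := by
  haveI : Fact (Nat.Prime 2) := ⟨Nat.prime_two⟩
  let G := absoluteGaloisGroup (v.adicCompletion ℚ)
  let Pt := localPoints W (v.adicCompletion ℚ)
  let N : Subgroup G := localSubgroup κ.kerSubgroup (v.adicCompletion ℚ)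
  let U : Subgroup G := LayerPairing.layerGroup κ v n
  haveI hNnormal : N.Normal := by
    change (localSubgroup κ.kerSubgroup (v.adicCompletion ℚ)).Normal
    rw [localSubgroup_eq_comap]; infer_instance
  have hNU : N ≤ U := TwistLayer.localSubgroup_le_layerGroup κ v n
  set A : AddSubgroup Pt := (⨆ i, signedLocalPoints κ (v.adicCompletion ℚ) W 1 i) with hAdef
  let B := W.geomTorsion ((2 ^ J : ℕ) : ℤ)
  let ι : B → Pt := fun b ↦ pointsMap W (v.adicCompletion ℚ) (b : W.geomPoints)
  have galois_smul_nsmul : ∀ (τ : G) (c : ℕ) (P : Pt), τ • (c • P) = c • (τ • P) :=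
    fun τ c P ↦ map_nsmul (DistribSMul.toAddMonoidHom Pt τ) c P
  have hιadd : ∀ a b : B, ι (a + b) = ι a + ι b := fun a b ↦ by
    change pointsMap W _ ((a : W.geomPoints) + b) = _; rw [map_add]
  have hιnsmul : ∀ (c : ℕ) (a : B), ι (c • a) = c • ι a := fun c a ↦ by
    change pointsMap W _ (((c • a : B) : W.geomPoints)) = _
    rw [AddSubgroupClass.coe_nsmul, map_nsmul]
  have hιgal : ∀ (τ : G) (a : B), ι (resGal (K := ℚ) (v.adicCompletion ℚ) τ • a) = τ • ι a := fun τ a ↦ by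
    change pointsMap W _ (((resGal (K := ℚ) (v.adicCompletion ℚ) τ • a : B) : W.geomPoints)) = _
    rw [Literature.NumberTheory.EllipticCurves.AddSubgroup.torsionBy.coe_smul, pointsMap_smul]
  have hιJ : ∀ b : B, 2 ^ J • ι b = 0 := fun b ↦ by
    rw [← hιnsmul, W.pow_nsmul_geomTorsion_pow 2 J b]
    change pointsMap W _ ((0 : B) : W.geomPoints) = 0
    rw [ZeroMemClass.coe_zero, map_zero]
  have hX : ∀ (x : U) (m : B), (subgroupRep (LayerPairing.torsionLocalRep W (2 ^ J) v) U).ρ x m =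
      resGal (K := ℚ) (v.adicCompletion ℚ) (x : G) • m := fun x m ↦ by
    rw [subgroupRep_ρ_apply, torsionLocalRep_ρ_apply]
  have hfι : ∀ (τ : G) (hτ : τ ∈ N), ι (f.1 ⟨τ, hNU hτ⟩) = τ • Q - Q := hf
  let σ' : U := ⟨σ, hσ⟩
  set c : Pt := ι (f.1 σ') with hc
  -- `D := σQ − Q − c` is fixed by `N`
  have hfixD : ∀ τ : G, τ ∈ N → τ • (σ • Q - Q - c) = σ • Q - Q - c := by
    intro τ' hτ'
    have hτ : σ⁻¹ * τ' * σ ∈ N := by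
      have h := Subgroup.Normal.conj_mem hNnormal τ' hτ' σ⁻¹
      rwa [inv_inv] at h
    have e1 : f.1 (σ' * ⟨σ⁻¹ * τ' * σ, hNU hτ⟩) =
        f.1 σ' + (subgroupRep (LayerPairing.torsionLocalRep W (2 ^ J) v) U).ρ σ' (f.1 ⟨σ⁻¹ * τ' * σ, hNU hτ⟩) := f.2 _ _
    have e2 : f.1 (⟨τ', hNU hτ'⟩ * σ') =
        f.1 ⟨τ', hNU hτ'⟩ + (subgroupRep (LayerPairing.torsionLocalRep W (2 ^ J) v) U).ρ ⟨τ', hNU hτ'⟩ (f.1 σ') := f.2 _ _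
    have e3 : σ' * ⟨σ⁻¹ * τ' * σ, hNU hτ⟩ = ⟨τ', hNU hτ'⟩ * σ' := Subtype.ext (by
      change σ * (σ⁻¹ * τ' * σ) = τ' * σ
      group)
    rw [e3, e2, hX, hX] at e1
    have e4 := congrArg ι e1
    rw [hιadd, hιadd, hιgal, hιgal, hfι τ' hτ', hfι _ hτ, smul_sub σ, ← hc] at e4
    have e5 : σ • ((σ⁻¹ * τ' * σ) • Q) = τ' • σ • Q := by
      rw [← mul_smul, ← mul_assoc, ← mul_assoc, mul_inv_cancel, one_mul, mul_smul]
    change τ' • Q - Q + τ' • c = c + (σ • ((σ⁻¹ * τ' * σ) • Q) - σ • Q) at e4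
    rw [e5] at e4
    have e6 : τ' • σ • Q = (τ' • Q - Q + τ' • c) - c + σ • Q := by
      calc τ' • σ • Q = (c + (τ' • σ • Q - σ • Q)) - c + σ • Q := by abel
        _ = (τ' • Q - Q + τ' • c) - c + σ • Q := by rw [← e4]
    rw [smul_sub, smul_sub, e6]
    abel
  have hDtower : σ • Q - Q - c ∈ localTowerPointsOfEmb κ (closureEmb (K := ℚ) (v.adicCompletion ℚ)) W :=
    (mem_localTowerPointsOfEmb_iff κ _ W _).2 hfixD
  have ha : 2 ^ J • Q ∈ A := nsmul_mem_of_layerWitness W hss κ J n v hv f Q hkQ hf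
  have hσa : σ • (2 ^ J • Q) ∈ A := PlusDualTwo.smul_mem_iSup_signedLocalPoints W κ v σ ha
  have h2D : 2 ^ J • (σ • Q - Q - c) = σ • (2 ^ J • Q) - 2 ^ J • Q := by
    rw [smul_sub, smul_sub, hc, hιJ, sub_zero, galois_smul_nsmul]
  have hDA : σ • Q - Q - c ∈ A := by
    refine mem_iSup_signedLocalPoints_of_pow_nsmul_mem W hss κ v hv hDtower (k := J) ?_
    rw [h2D]
    exact sub_mem hσa ha
  exact ⟨σ • Q - Q - c, hDA, h2D.symm⟩

/-! ## §2 The two cosets of `U_{n+1}` in `U_n` -/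

omit [W.IsElliptic] [W.IsGloballyMinimal] in
/-- `U_n = U_{n+1} ∪ g^{2^n}·U_{n+1}`: for `σ ∈ U_n` either `σ ∈ U_{n+1}` or `g^{-2^n} σ ∈ U_{n+1}` (`κ(σ) = 2^n y` and `y ≡ 0` or `1 (mod 2)`).
[cite: Washington1997, §13.1] -/
theorem mem_layerGroup_succ_or (κ : ZpExtension ℚ 2) (v : HeightOneSpectrum (𝓞 ℚ)) {g : absoluteGaloisGroup (v.adicCompletion ℚ)}
    (hg : κ.IsTopGenerator (resGalOfEmb (closureEmb (K := ℚ) (v.adicCompletion ℚ)) g)) (n : ℕ)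
    {σ : absoluteGaloisGroup (v.adicCompletion ℚ)} (hσ : σ ∈ LayerPairing.layerGroup κ v n) :
    σ ∈ LayerPairing.layerGroup κ v (n + 1) ∨ (g ^ (2 ^ n))⁻¹ * σ ∈ LayerPairing.layerGroup κ v (n + 1) := by
  haveI : Fact (Nat.Prime 2) := ⟨Nat.prime_two⟩
  have hg1 : κ (resGal (K := ℚ) (v.adicCompletion ℚ) g) = Multiplicative.ofAdd 1 := by rw [resGal_eq]; exact hg
  have hσ' : (2 : ℤ_[2]) ^ n ∣ (κ (resGal (K := ℚ) (v.adicCompletion ℚ) σ)).toAdd := by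
    have h := (mem_localSubgroupOfEmb_iff _ _ _).mp hσ
    rw [← resGal_eq, ZpExtension.mem_layerSubgroup] at h
    exact_mod_cast h
  obtain ⟨y, hy⟩ := hσ'
  -- `y ≡ 0` or `1 (mod 2)`
  have hr := PadicInt.zmodRepr_lt_p y
  have hsub : y - (PadicInt.zmodRepr y : ℤ_[2]) ∈ IsLocalRing.maximalIdeal ℤ_[2] := PadicInt.sub_zmodRepr_mem y
  rw [PadicInt.maximalIdeal_eq_span_p, Ideal.mem_span_singleton] at hsub
  obtain ⟨z, hz⟩ := hsub
  interval_cases hrep : PadicInt.zmodRepr y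
  · -- `y = 2 z`: `σ ∈ U_{n+1}`
    left
    refine (mem_localSubgroupOfEmb_iff _ _ _).mpr ?_
    rw [← resGal_eq, ZpExtension.mem_layerSubgroup]
    refine ⟨z, ?_⟩
    have hy' : y = 2 * z := by
      have h := hz
      push_cast at h
      linear_combination h
    have hy2 : (κ (resGal (K := ℚ) (v.adicCompletion ℚ) σ)).toAdd = (2 : ℤ_[2]) ^ n * y := by exact_mod_cast hy
    rw [hy2, hy', pow_succ]
    ring
  · -- `y = 2 z + 1`: `g^{-2^n} σ ∈ U_{n+1}`
    right
    refine (mem_localSubgroupOfEmb_iff _ _ _).mpr ?_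
    rw [← resGal_eq, ZpExtension.mem_layerSubgroup, map_mul, map_inv, map_pow, map_mul, map_inv, map_pow, hg1, toAdd_mul,
      toAdd_inv, ← ofAdd_nsmul, toAdd_ofAdd, nsmul_eq_mul, mul_one]
    refine ⟨z, ?_⟩
    have hy' : y = 2 * z + 1 := by
      have h := hz
      push_cast at h
      linear_combination h
    have hy2 : (κ (resGal (K := ℚ) (v.adicCompletion ℚ) σ)).toAdd = (2 : ℤ_[2]) ^ n * y := by exact_mod_cast hy
    rw [hy2, hy', pow_succ]
    push_cast
    ring

omit [W.IsElliptic] [W.IsGloballyMinimal] in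
/-- `g^{2^n} ∉ U_{n+1}` (`κ(g^{2^n}) = 2^n` is not divisible by `2^{n+1}` in `ℤ₂`). [cite: Washington1997, §13.1] -/
theorem pow_not_mem_layerGroup_succ (κ : ZpExtension ℚ 2) (v : HeightOneSpectrum (𝓞 ℚ)) {g : absoluteGaloisGroup (v.adicCompletion ℚ)}
    (hg : κ.IsTopGenerator (resGalOfEmb (closureEmb (K := ℚ) (v.adicCompletion ℚ)) g)) (n : ℕ) :
    g ^ (2 ^ n) ∉ LayerPairing.layerGroup κ v (n + 1) := by
  haveI : Fact (Nat.Prime 2) := ⟨Nat.prime_two⟩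
  have hg1 : κ (resGal (K := ℚ) (v.adicCompletion ℚ) g) = Multiplicative.ofAdd 1 := by rw [resGal_eq]; exact hg
  intro h
  have h' := (mem_localSubgroupOfEmb_iff _ _ _).mp h
  rw [← resGal_eq, ZpExtension.mem_layerSubgroup, map_pow, map_pow, hg1, ← ofAdd_nsmul, toAdd_ofAdd, nsmul_eq_mul, mul_one] at h'
  obtain ⟨z, hz⟩ := h'
  have hz' : (2 : ℤ_[2]) ^ n * (1 - 2 * z) = 0 := by
    rw [mul_sub, mul_one, ← mul_assoc, ← pow_succ]
    exact sub_eq_zero.mpr (by exact_mod_cast hz)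
  have hpa : ((2 : ℤ_[2]) ^ n) ≠ 0 := pow_ne_zero _ (Nat.cast_ne_zero.mpr two_ne_zero)
  have h1 : (1 : ℤ_[2]) - 2 * z = 0 := (mul_eq_zero.mp hz').resolve_left hpa
  have h2 : ‖(2 : ℤ_[2]) * z‖ < 1 := by
    rw [norm_mul]
    calc ‖(2 : ℤ_[2])‖ * ‖z‖ ≤ ‖(2 : ℤ_[2])‖ * 1 := by gcongr; exact PadicInt.norm_le_one z
      _ < 1 := by rw [mul_one]; exact_mod_cast (PadicInt.norm_lt_one_iff_dvd (2 : ℤ_[2])).mpr (by exact_mod_cast dvd_refl (2 : ℤ_[2]))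
  have h3 : ‖(2 : ℤ_[2]) * z‖ = 1 := by rw [← sub_eq_zero.mp h1]; exact norm_one
  exact absurd h3 (ne_of_lt h2)

omit [W.IsElliptic] [W.IsGloballyMinimal] in
/-- **The quotient `U_n ⧸ U_{n+1}` has exactly the two classes of `1` and `g^{2^n}`**, which are distinct. [cite: Washington1997, §13.1] -/
theorem quotient_layerGroup_eq_or (κ : ZpExtension ℚ 2) (v : HeightOneSpectrum (𝓞 ℚ)) {g : absoluteGaloisGroup (v.adicCompletion ℚ)}
    (hg : κ.IsTopGenerator (resGalOfEmb (closureEmb (K := ℚ) (v.adicCompletion ℚ)) g)) (n : ℕ)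
    (x : LayerPairing.layerGroup κ v n ⧸ (LayerPairing.layerGroup κ v (n + 1)).subgroupOf (LayerPairing.layerGroup κ v n)) :
    (x = ((1 : LayerPairing.layerGroup κ v n) : _ ⧸ _) ∨
      x = ((⟨g ^ (2 ^ n), pow_mem_layerGroup κ v hg n⟩ : LayerPairing.layerGroup κ v n) : _ ⧸ _)) ∧
    ((1 : LayerPairing.layerGroup κ v n) : LayerPairing.layerGroup κ v n ⧸
        (LayerPairing.layerGroup κ v (n + 1)).subgroupOf (LayerPairing.layerGroup κ v n)) ≠
      ((⟨g ^ (2 ^ n), pow_mem_layerGroup κ v hg n⟩ : LayerPairing.layerGroup κ v n) : _ ⧸ _) := by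
  constructor
  · induction x using QuotientGroup.induction_on with
    | H σ =>
      rcases mem_layerGroup_succ_or κ v hg n σ.2 with h | h
      · left
        rw [QuotientGroup.eq, Subgroup.mem_subgroupOf]
        simpa using (LayerPairing.layerGroup κ v (n + 1)).inv_mem h
      · right
        rw [QuotientGroup.eq, Subgroup.mem_subgroupOf]
        have h2 := (LayerPairing.layerGroup κ v (n + 1)).inv_mem h
        rw [mul_inv_rev, inv_inv] at h2
        simpa using h2
  · intro h
    rw [QuotientGroup.eq, Subgroup.mem_subgroupOf] at h
    have h2 : g ^ (2 ^ n) ∈ LayerPairing.layerGroup κ v (n + 1) := by simpa using h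
    exact pow_not_mem_layerGroup_succ κ v hg n h2

omit [W.IsElliptic] [W.IsGloballyMinimal] in
/-- **A sum over `U_n ⧸ U_{n+1}` is the sum of the values at the classes of `1` and `g^{2^n}`.** [cite: Washington1997, §13.1] -/
theorem sum_quotient_layerGroup_eq (κ : ZpExtension ℚ 2) (v : HeightOneSpectrum (𝓞 ℚ)) {g : absoluteGaloisGroup (v.adicCompletion ℚ)}
    (hg : κ.IsTopGenerator (resGalOfEmb (closureEmb (K := ℚ) (v.adicCompletion ℚ)) g)) (n : ℕ)
    [Fintype (LayerPairing.layerGroup κ v n ⧸ (LayerPairing.layerGroup κ v (n + 1)).subgroupOf (LayerPairing.layerGroup κ v n))]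
    {M : Type*} [AddCommMonoid M]
    (F : LayerPairing.layerGroup κ v n ⧸ (LayerPairing.layerGroup κ v (n + 1)).subgroupOf (LayerPairing.layerGroup κ v n) → M) :
    ∑ x, F x = F ((1 : LayerPairing.layerGroup κ v n) : _ ⧸ _) +
      F ((⟨g ^ (2 ^ n), pow_mem_layerGroup κ v hg n⟩ : LayerPairing.layerGroup κ v n) : _ ⧸ _) := by
  obtain ⟨-, hne⟩ := quotient_layerGroup_eq_or κ v hg n ((1 : LayerPairing.layerGroup κ v n) : _ ⧸ _)
  have huniv : (Finset.univ : Finset (LayerPairing.layerGroup κ v n ⧸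
      (LayerPairing.layerGroup κ v (n + 1)).subgroupOf (LayerPairing.layerGroup κ v n))) =
      {((1 : LayerPairing.layerGroup κ v n) : _ ⧸ _),
        ((⟨g ^ (2 ^ n), pow_mem_layerGroup κ v hg n⟩ : LayerPairing.layerGroup κ v n) : _ ⧸ _)} := by
    ext x
    simp only [Finset.mem_univ, Finset.mem_insert, Finset.mem_singleton, true_iff]
    exact (quotient_layerGroup_eq_or κ v hg n x).1
  rw [huniv, Finset.sum_pair hne]

/-! ## §3 The norm step on witness points -/

/-- **The NORM STEP: `cor_{U_{n+1}→U_n}` of a witness class sits at `a + g^{2^n} a`.** For a `U_{n+1}`-cocycle `f` of `E[2^J]|` with witness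
`(Q, k)` there are a representative `F` of `cor_{U_{n+1}→U_n}[f]` and a witness `Q'` of `F` with `2^{k'} Q' ∈ A` and
`2^J Q' − (2^J Q + g^{2^n}(2^J Q)) ∈ 2^J A`. (Representatives `s` of the two cosets with `s(1) = 1`; `s(ḡ) = g^{2^n}τ'`, `τ' ∈ U_{n+1}`, moves
`2^J Q` inside its class by §1.) [cite: BDKim2007, Prop. 3.15 (proof, «Cor^m_n(H_m[p^j]) = H_n[p^j]»)] [cite: NeukirchSchmidtWingberg2008, I §5] -/
theorem exists_coresLe_witness_norm (hss : Rank1Residual.GoodSS W 2) (κ : ZpExtension ℚ 2) (J n : ℕ)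
    (v : HeightOneSpectrum (𝓞 ℚ)) (hv : (2 : 𝓞 ℚ) ∈ v.asIdeal) {g : absoluteGaloisGroup (v.adicCompletion ℚ)}
    (hg : κ.IsTopGenerator (resGalOfEmb (closureEmb (K := ℚ) (v.adicCompletion ℚ)) g))
    [Fintype (LayerPairing.layerGroup κ v n ⧸ (LayerPairing.layerGroup κ v (n + 1)).subgroupOf (LayerPairing.layerGroup κ v n))]
    (f : contOneCocycles (subgroupRep (LayerPairing.torsionLocalRep W (2 ^ J) v) (LayerPairing.layerGroup κ v (n + 1))))
    (Q : localPoints W (v.adicCompletion ℚ)) {k : ℕ}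
    (hkQ : 2 ^ k • Q ∈ (⨆ i, signedLocalPoints κ (v.adicCompletion ℚ) W 1 i))
    (hf : ∀ (τ : absoluteGaloisGroup (v.adicCompletion ℚ)) (hτ : τ ∈ localSubgroup κ.kerSubgroup (v.adicCompletion ℚ)),
      pointsMap W (v.adicCompletion ℚ) ((f.1 ⟨τ, TwistLayer.localSubgroup_le_layerGroup κ v (n + 1) hτ⟩ : W.geomTorsion ((2 ^ J : ℕ) : ℤ)) :
        W.geomPoints) = τ • Q - Q) :
    ∃ (F : contOneCocycles (subgroupRep (LayerPairing.torsionLocalRep W (2 ^ J) v) (LayerPairing.layerGroup κ v n)))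
      (Q' : localPoints W (v.adicCompletion ℚ)),
      oneCocycleClass _ F = coresLe (LayerPairing.torsionLocalRep W (2 ^ J) v) (LayerPairing.layerGroup_antitone κ v n)
        (LayerPairing.isOpen_layerGroup κ v (n + 1)) (oneCocycleClass _ f) ∧
      2 ^ k • Q' ∈ (⨆ i, signedLocalPoints κ (v.adicCompletion ℚ) W 1 i) ∧
      (∀ (τ : absoluteGaloisGroup (v.adicCompletion ℚ)) (hτ : τ ∈ localSubgroup κ.kerSubgroup (v.adicCompletion ℚ)),
      pointsMap W (v.adicCompletion ℚ) ((F.1 ⟨τ, TwistLayer.localSubgroup_le_layerGroup κ v n hτ⟩ : W.geomTorsion ((2 ^ J : ℕ) : ℤ)) :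
        W.geomPoints) = τ • Q' - Q') ∧
      ∃ w ∈ (⨆ i, signedLocalPoints κ (v.adicCompletion ℚ) W 1 i), 2 ^ J • Q' - (2 ^ J • Q + g ^ (2 ^ n) • (2 ^ J • Q)) = 2 ^ J • w := by
  haveI : Fact (Nat.Prime 2) := ⟨Nat.prime_two⟩
  let G := absoluteGaloisGroup (v.adicCompletion ℚ)
  let Pt := localPoints W (v.adicCompletion ℚ)
  set A : AddSubgroup Pt := (⨆ i, signedLocalPoints κ (v.adicCompletion ℚ) W 1 i) with hAdef
  have galois_smul_nsmul : ∀ (τ : G) (c : ℕ) (P : Pt), τ • (c • P) = c • (τ • P) :=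
    fun τ c P ↦ map_nsmul (DistribSMul.toAddMonoidHom Pt τ) c P
  -- representatives of the two cosets, with `s(1) = 1`
  obtain ⟨s, hs, hs1⟩ := exists_reps_one ((LayerPairing.layerGroup κ v (n + 1)).subgroupOf (LayerPairing.layerGroup κ v n))
  obtain ⟨F, hF, hFwit⟩ := LayerClassPairing.exists_coresLe_cocycle_of_layerWitness W (2 ^ J) κ v n hs f Q hf
  let γ : LayerPairing.layerGroup κ v n := ⟨g ^ (2 ^ n), pow_mem_layerGroup κ v hg n⟩
  -- `s(ḡ) = g^{2^n} τ'` with `τ' ∈ U_{n+1}`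
  have hτ' : (g ^ (2 ^ n))⁻¹ * ((s (γ : _ ⧸ _) : LayerPairing.layerGroup κ v n) : G) ∈ LayerPairing.layerGroup κ v (n + 1) := by
    have h := hs (γ : _ ⧸ _)
    rw [QuotientGroup.eq, Subgroup.mem_subgroupOf] at h
    have h2 := (LayerPairing.layerGroup κ v (n + 1)).inv_mem h
    rw [Subgroup.coe_mul, Subgroup.coe_inv, mul_inv_rev, inv_inv] at h2
    exact h2
  set Q' : Pt := ∑ x, ((s x : LayerPairing.layerGroup κ v n) : G) • Q with hQ'def
  have hsum : Q' = Q + ((s (γ : _ ⧸ _) : LayerPairing.layerGroup κ v n) : G) • Q := by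
    rw [hQ'def, sum_quotient_layerGroup_eq κ v hg n, hs1, OneMemClass.coe_one, one_smul]
  refine ⟨F, Q', hF, ?_, hFwit, ?_⟩
  · -- `2^k Q' ∈ A`
    rw [hQ'def, Finset.smul_sum]
    exact A.sum_mem fun x _ ↦ by
      rw [← galois_smul_nsmul]; exact PlusDualTwo.smul_mem_iSup_signedLocalPoints W κ v _ hkQ
  · -- the norm congruence
    obtain ⟨w, hwA, hw⟩ := exists_smul_sub_eq_of_layerWitness W hss κ J (n + 1) v hv f Q hkQ hf _ hτ'
    refine ⟨g ^ (2 ^ n) • w, PlusDualTwo.smul_mem_iSup_signedLocalPoints W κ v _ hwA, ?_⟩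
    have e1 : ((s (γ : _ ⧸ _) : LayerPairing.layerGroup κ v n) : G) • (2 ^ J • Q) =
        g ^ (2 ^ n) • (((g ^ (2 ^ n))⁻¹ * ((s (γ : _ ⧸ _) : LayerPairing.layerGroup κ v n) : G)) • (2 ^ J • Q)) := by
      rw [← mul_smul, ← mul_assoc, mul_inv_cancel, one_mul]
    have e2 : ((g ^ (2 ^ n))⁻¹ * ((s (γ : _ ⧸ _) : LayerPairing.layerGroup κ v n) : G)) • (2 ^ J • Q) = 2 ^ J • Q + 2 ^ J • w := by
      rw [← hw]; abel
    rw [hsum, smul_add, ← galois_smul_nsmul, e1, e2, smul_add, galois_smul_nsmul (g ^ (2 ^ n)) (2 ^ J) w]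
    abel

end Summit.BirchSwinnertonDyer.BirchSwinnertonDyer.Theorems.SignedEC.LayerIsoAssembly

end
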